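import Summits.ValiantsHypothesis.ValiantsHypothesis.Theorems.NNDivisionHard.Negative.AsymmetricWindowSlice
import Literature.Computability.MetaComplexity.ParityDNF

/-!
# AsymmetricWindow39 — PART 2: §3 the located neighbourhood (informative rows)

Theorems-side port (val-port-1 g4, desk #458/#459 hand; critic of record val-idea-crit-9 g3 V#139a KERNEL OF RECORD) of val-idea-39 g6's crux workfile
`Cruxes/NNDivisionHard/AsymmetricWindow39.lean` @4f29a1b2abda (sha16 404e3fcf456bdce2, 470 l., 24 decls): declaration texts VERBATIM, split at the §2/§3
seam for the 400-line norm into `Theorems/NNDivisionHard/Negative/AsymmetricWindowSlice.lean` (§1 sliced Kaibel–Weltge + §2 pencil/monotonicity) and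
`Theorems/NNDivisionHard/Negative/AsymmetricWindowInformative.lean` (§3 informative rows; imports the first); namespace moved to
`Summit.ValiantsHypothesis.Theorems.NNDivisionHardNegative.AsymmetricWindow` (Negative-lane convention).  S2 INSTRUMENTS (census rows S2-K1/K2/K3), helper lane;
nothing closes; `NNDivisionHard` (stmt-21181) OPEN; VP ≠ VNP NOT proved.
Part 1 = `…Negative.AsymmetricWindowSlice` (§1–§2).
-/


namespace Summit.ValiantsHypothesis.Theorems.NNDivisionHardNegative.AsymmetricWindow

open Finset
open Literature.Barriers.PneNP (disjPairs mem_disjPairs IsKWValid disjPairs_filter_fst_eq)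
open Literature.Combinatorics.Optimization (HasNonnegFactorization hasNonnegFactorization_of_fintype)
open Summit.ValiantsHypothesis.Theorems.NNDivisionHardNegative.BlindCubeIdentity (ind ind_nonneg ind_le_one)
open Summit.ValiantsHypothesis.Theorems.NNDivisionHardNegative.WeakReliefBlind (inv invInd invInd_nonneg)

/-! ## §3  The located neighbourhood: per column and slice only `(w+1)^{2√w}` rows have flood `inv ≤ w`

This is the counting fact behind the exponent `λ^{-1/2}` of T3 and behind ceiling (i) of the memo: an entry
`M_λ[a;(b,π)]` is informative (`λ·inv(a;π) ≤ W`) only if `a` differs from the located base `P_k(π)` by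
`j ≤ √(W/λ)` swaps inside the two position windows of width `W/λ` around the cut `k`; so every method whose
witness lives on the informative entries of one column (corruption / discrepancy / common information per
cluster) sees at most `(W/λ + 1)^{2√(W/λ)} = 2^{Õ(λ^{-1/2})}` rows. -/

section Informative

variable {n : ℕ}

open Summit.ValiantsHypothesis.Theorems.NNDivisionHardNegative.WeakReliefBlind (posLT card_posLT)

/-- membership in the located initial segment `P_m(π) = {l : π(l) < m}` -/
theorem mem_posLT_iff (π : Equiv.Perm (Fin n)) (m : ℕ) (l : Fin n) : l ∈ posLT π m ↔ (π l : ℕ) < m := by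
  simp [posLT]

/-- `|P_m(π)| ≤ m` for every `m` (with equality for `m ≤ n`, `card_posLT`). -/
theorem card_posLT_le (π : Equiv.Perm (Fin n)) (m : ℕ) : (posLT π m).card ≤ m := by
  by_cases hm : m ≤ n
  · exact (card_posLT π hm).le
  · calc (posLT π m).card ≤ (Finset.univ : Finset (Fin n)).card := card_le_card (Finset.subset_univ _)
      _ ≤ m := by rw [Finset.card_univ, Fintype.card_fin]; exact (Nat.lt_of_not_le hm).le

/-- `P_m(π) ⊆ P_{m'}(π)` for `m ≤ m'`. -/
theorem posLT_mono (π : Equiv.Perm (Fin n)) {m m' : ℕ} (h : m ≤ m') : posLT π m ⊆ posLT π m' := by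
  intro l hl
  rw [mem_posLT_iff] at hl ⊢
  exact lt_of_lt_of_le hl h

/-- the inversion pairs of the row `a` against `π`: `(l, l′)` with `l ∈ a`, `l′ ∉ a`, `π(l′) < π(l)` -/
def invPairs (a : Finset (Fin n)) (π : Equiv.Perm (Fin n)) : Finset (Fin n × Fin n) :=
  Finset.univ.filter fun p => p.1 ∈ a ∧ p.2 ∉ a ∧ π p.2 < π p.1

/-- membership in `invPairs a π`, unfolded. -/
theorem mem_invPairs {a : Finset (Fin n)} {π : Equiv.Perm (Fin n)} {p : Fin n × Fin n} :
    p ∈ invPairs a π ↔ p.1 ∈ a ∧ p.2 ∉ a ∧ π p.2 < π p.1 := by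
  simp [invPairs]

/-- `inv(a;π)` is the number of inversion pairs. -/
theorem inv_eq_card_invPairs (a : Finset (Fin n)) (π : Equiv.Perm (Fin n)) :
    inv a π = ((invPairs a π).card : ℤ) := by
  unfold inv invPairs
  rw [Finset.card_filter]
  push_cast
  rw [← Finset.sum_product' (f := fun l l' => ind a l * (1 - ind a l') * invInd π l l')]
  refine Finset.sum_congr rfl fun p _ => ?_
  unfold ind invInd
  by_cases h1 : p.1 ∈ a <;> by_cases h2 : p.2 ∈ a <;> by_cases h3 : π p.2 < π p.1 <;> simp [h1, h2, h3]

/-- **Boundary pairs are inversions:** every pair `(o ∈ a ∖ P_k(π), i ∈ P_k(π) ∖ a)` is an inversion, so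
`|a ∖ P_k(π)| · |P_k(π) ∖ a| ≤ inv(a;π)`. -/
theorem card_sdiff_mul_le_inv (a : Finset (Fin n)) (π : Equiv.Perm (Fin n)) (k : ℕ) :
    (((a \ posLT π k).card * (posLT π k \ a).card : ℕ) : ℤ) ≤ inv a π := by
  rw [inv_eq_card_invPairs, ← Finset.card_product]
  have hsub : (a \ posLT π k) ×ˢ (posLT π k \ a) ⊆ invPairs a π := by
    intro p hp
    rw [Finset.mem_product, Finset.mem_sdiff, Finset.mem_sdiff, mem_posLT_iff, mem_posLT_iff] at hp
    obtain ⟨⟨ho, hok⟩, hik, hia⟩ := hp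
    refine mem_invPairs.2 ⟨ho, hia, ?_⟩
    rw [Fin.lt_def]
    omega
  exact_mod_cast card_le_card hsub

/-- **Upper window:** an element `o ∈ a` beyond the cut (`π(o) ≥ k`, `|a| = k`) alone forces
`π(o) + 1 − k ≤ inv(a;π)` (the `π(o)` smaller positions hold at most `k − 1` elements of `a`). -/
theorem pos_add_one_sub_le_inv {a : Finset (Fin n)} {k : ℕ} (hak : a.card = k) (π : Equiv.Perm (Fin n))
    {o : Fin n} (ho : o ∈ a \ posLT π k) : ((π o : ℕ) : ℤ) + 1 - k ≤ inv a π := by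
  rw [inv_eq_card_invPairs]
  have hoa : o ∈ a := (Finset.mem_sdiff.1 ho).1
  have hsub : ({o} : Finset (Fin n)) ×ˢ (posLT π (π o) \ a) ⊆ invPairs a π := by
    intro p hp
    rw [Finset.mem_product, Finset.mem_singleton, Finset.mem_sdiff, mem_posLT_iff] at hp
    obtain ⟨hp1, hl', hl'a⟩ := hp
    refine mem_invPairs.2 ⟨hp1 ▸ hoa, hl'a, ?_⟩
    rw [Fin.lt_def, hp1]
    exact hl'
  have h1 := Finset.card_sdiff_add_card_inter (posLT π (π o)) a
  have hX : (posLT π (π o)).card = (π o : ℕ) := card_posLT π (π o).is_lt.le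
  have h2 : (posLT π (π o) ∩ a).card ≤ k - 1 := by
    have hsub' : posLT π (π o) ∩ a ⊆ a.erase o := by
      intro l hl
      rw [Finset.mem_inter, mem_posLT_iff] at hl
      rw [Finset.mem_erase]
      refine ⟨?_, hl.2⟩
      rintro rfl
      exact lt_irrefl _ hl.1
    calc (posLT π (π o) ∩ a).card ≤ (a.erase o).card := card_le_card hsub'
      _ = k - 1 := by rw [Finset.card_erase_of_mem hoa, hak]
  have hk1 : 1 ≤ k := by rw [← hak]; exact Finset.card_pos.2 ⟨o, hoa⟩
  have h3 := card_le_card hsub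
  rw [Finset.card_product, Finset.card_singleton, one_mul] at h3
  have h4 : (π o : ℕ) + 1 - k ≤ (invPairs a π).card := by omega
  omega

/-- **Lower window:** an element `i ∉ a` before the cut (`π(i) < k`, `|a| = k`) alone forces
`k − π(i) ≤ inv(a;π)` (the positions above `π(i)` miss at most `π(i)` elements of `a`). -/
theorem sub_pos_le_inv {a : Finset (Fin n)} {k : ℕ} (hak : a.card = k) (π : Equiv.Perm (Fin n))
    {i : Fin n} (hi : i ∈ posLT π k \ a) : (k : ℤ) - (π i : ℕ) ≤ inv a π := by
  rw [inv_eq_card_invPairs]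
  have hia : i ∉ a := (Finset.mem_sdiff.1 hi).2
  have hsub : (a \ posLT π ((π i : ℕ) + 1)) ×ˢ ({i} : Finset (Fin n)) ⊆ invPairs a π := by
    intro p hp
    rw [Finset.mem_product, Finset.mem_singleton, Finset.mem_sdiff, mem_posLT_iff] at hp
    obtain ⟨⟨hl, hlX⟩, hp2⟩ := hp
    refine mem_invPairs.2 ⟨hl, hp2 ▸ hia, ?_⟩
    rw [Fin.lt_def, hp2]
    omega
  have h1 := Finset.card_sdiff_add_card_inter a (posLT π ((π i : ℕ) + 1))
  have hX : (posLT π ((π i : ℕ) + 1)).card = (π i : ℕ) + 1 := card_posLT π (π i).is_lt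
  have h2 : (a ∩ posLT π ((π i : ℕ) + 1)).card ≤ (π i : ℕ) := by
    have hsub' : a ∩ posLT π ((π i : ℕ) + 1) ⊆ (posLT π ((π i : ℕ) + 1)).erase i := by
      intro l hl
      rw [Finset.mem_inter] at hl
      rw [Finset.mem_erase]
      refine ⟨?_, hl.2⟩
      rintro rfl
      exact hia hl.1
    calc (a ∩ posLT π ((π i : ℕ) + 1)).card ≤ ((posLT π ((π i : ℕ) + 1)).erase i).card := card_le_card hsub'
      _ = (π i : ℕ) := by
          rw [Finset.card_erase_of_mem ((mem_posLT_iff _ _ _).2 (Nat.lt_succ_self _)), hX]; rfl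
  have h3 := card_le_card hsub
  rw [Finset.card_product, Finset.card_singleton, mul_one] at h3
  have h4 : k - (π i : ℕ) ≤ (invPairs a π).card := by omega
  omega

/-- **Structure of the informative rows.**  If `|a| = k ≤ n` and `inv(a;π) ≤ w` then `a` is the base `P_k(π)`
with `j` elements of the upper window `{k ≤ π < k + w}` swapped in for `j` elements of the lower window
`{k − w ≤ π < k}`, and `j² ≤ w`. -/
theorem informative_row_structure (π : Equiv.Perm (Fin n)) {k : ℕ} (hkn : k ≤ n) (w : ℕ)
    {a : Finset (Fin n)} (hak : a.card = k) (hw : inv a π ≤ w) :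
    a \ posLT π k ⊆ posLT π (k + w) \ posLT π k ∧
    posLT π k \ a ⊆ posLT π k \ posLT π (k - w) ∧
    (posLT π k \ a).card = (a \ posLT π k).card ∧
    (a \ posLT π k).card * (a \ posLT π k).card ≤ w := by
  have hPk : (posLT π k).card = k := card_posLT π hkn
  have hcard : (posLT π k \ a).card = (a \ posLT π k).card := by
    have h1 := Finset.card_sdiff_add_card_inter (posLT π k) a
    have h2 := Finset.card_sdiff_add_card_inter a (posLT π k)
    rw [Finset.inter_comm] at h2
    omega
  refine ⟨?_, ?_, hcard, ?_⟩
  · intro o ho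
    have h := pos_add_one_sub_le_inv hak π ho
    rw [Finset.mem_sdiff] at ho ⊢
    refine ⟨(mem_posLT_iff _ _ _).2 ?_, ho.2⟩
    have : ((π o : ℕ) : ℤ) + 1 - k ≤ w := le_trans h hw
    omega
  · intro i hi
    have h := sub_pos_le_inv hak π hi
    rw [Finset.mem_sdiff] at hi ⊢
    refine ⟨hi.1, fun hlt => ?_⟩
    rw [mem_posLT_iff] at hlt
    have : (k : ℤ) - (π i : ℕ) ≤ w := le_trans h hw
    omega
  · have h := le_trans (card_sdiff_mul_le_inv a π k) hw
    rw [hcard] at h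
    exact_mod_cast h

/-- The subsets of `X` of size at most `J` number at most `(|X|+1)^J`. [folklore] -/
theorem card_powerset_filter_card_le_pow {β : Type*} [DecidableEq β] (X : Finset β) (J : ℕ) :
    (X.powerset.filter fun S => S.card ≤ J).card ≤ (X.card + 1) ^ J := by
  have hsub : (X.powerset.filter fun S => S.card ≤ J) ⊆ (range (J + 1)).biUnion fun s => powersetCard s X := by
    intro S hS
    rw [mem_filter, mem_powerset] at hS
    rw [mem_biUnion]
    exact ⟨S.card, mem_range.2 (Nat.lt_succ_of_le hS.2), mem_powersetCard.2 ⟨hS.1, rfl⟩⟩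
  refine (card_le_card hsub).trans ((card_biUnion_le).trans ?_)
  simp only [card_powersetCard]
  exact Literature.Computability.MetaComplexity.sum_range_succ_choose_le_pow X.card J

/-- **The located neighbourhood is small:** per column `π` and slice `k ≤ n`, at most `((w+1)^{√w})²` rows
`a` have `inv(a;π) ≤ w` — independently of `n`.  (With `w = W/λ`: `2^{O(λ^{-1/2}·log(W/λ))}` informative
rows per column; ceiling (i) of the memo.) -/
theorem card_informative_rows_le (π : Equiv.Perm (Fin n)) {k : ℕ} (hkn : k ≤ n) (w : ℕ) :
    ((Finset.univ : Finset (Finset (Fin n))).filter (fun a => a.card = k ∧ inv a π ≤ w)).card ≤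
      ((w + 1) ^ Nat.sqrt w) ^ 2 := by
  classical
  set A := posLT π (k + w) \ posLT π k with hA
  set B := posLT π k \ posLT π (k - w) with hB
  set FA := A.powerset.filter fun S => S.card ≤ Nat.sqrt w with hFA
  set FB := B.powerset.filter fun S => S.card ≤ Nat.sqrt w with hFB
  have hAc : A.card ≤ w := by
    rw [hA, card_sdiff_of_subset (posLT_mono π (Nat.le_add_right k w)), card_posLT π hkn]
    have := card_posLT_le π (k + w)
    omega
  have hBc : B.card ≤ w := by
    rw [hB, card_sdiff_of_subset (posLT_mono π (Nat.sub_le k w)), card_posLT π hkn,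
      card_posLT π ((Nat.sub_le k w).trans hkn)]
    omega
  have hinj : ((Finset.univ : Finset (Finset (Fin n))).filter (fun a => a.card = k ∧ inv a π ≤ w)).card ≤
      (FA ×ˢ FB).card := by
    refine Finset.card_le_card_of_injOn (fun a => (a \ posLT π k, posLT π k \ a)) ?_ ?_
    · intro a ha
      rw [Finset.mem_coe, mem_filter] at ha
      obtain ⟨h1, h2, h3, h4⟩ := informative_row_structure π hkn w ha.2.1 ha.2.2
      rw [Finset.mem_coe, Finset.mem_product, hFA, hFB, mem_filter, mem_filter, mem_powerset, mem_powerset]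
      refine ⟨⟨h1, Nat.le_sqrt.2 h4⟩, ⟨h2, ?_⟩⟩
      rw [h3]; exact Nat.le_sqrt.2 h4
    · intro a _ a' _ h
      simp only [Prod.mk.injEq] at h
      obtain ⟨ho, hi⟩ := h
      have key : ∀ s : Finset (Fin n), s = (posLT π k \ (posLT π k \ s)) ∪ (s \ posLT π k) := by
        intro s; ext l
        simp only [Finset.mem_union, Finset.mem_sdiff]
        tauto
      rw [key a, key a', ho, hi]
  refine hinj.trans ?_
  rw [Finset.card_product, sq]
  refine Nat.mul_le_mul ?_ ?_
  · exact (card_powerset_filter_card_le_pow A _).trans (Nat.pow_le_pow_left (by omega) _)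
  · exact (card_powerset_filter_card_le_pow B _).trans (Nat.pow_le_pow_left (by omega) _)

end Informative

end Summit.ValiantsHypothesis.Theorems.NNDivisionHardNegative.AsymmetricWindow
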